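import Summits.BirchSwinnertonDyer.BirchSwinnertonDyer.Theorems.UniversalToricDescentTwinCoherentHeegnerFamily
import Literature.NumberTheory.EllipticCurves.GreenbergSelmer
import HarnessLib
import HarnessLib.Audit.Tags

/-!
# Route `UniversalToricDescent` — light defs module for the research stub K1″ `PrincipalHeegnerIndivisibleMultAtThree`
# (crux r205 stmt-BirchSwinnertonDyer-24737 `TwinAlgMuZeroAtThree`, line `beta-road`, skeleton v16 sha16 a84e0bb203085cb5)

Cell `pub/bsd-wall`, LEAD lineage `bsd-wall-utd-p1` (g29), 2026-08-30; `--supports stmt-BirchSwinnertonDyer-24737 --as helper`.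
Companion of `UniversalToricDescentKsTwinLambdaDefs` (p770265, the K2a‴ stub as the constant `KsTwinLambdaAdicAtThree`):
this module names the line's OTHER research stub, K1″ `stub_principalHeegnerIndivisibleMult`, as ONE constant, so that the
line's composition «K1″ ∧ K2a‴ (∧ the C₀ bucket) ⟹ crux 24737» can be landed as a sorry-free Theorems theorem with its research
inputs as hypotheses BY NAME, and so that the β-instrument / disprover seats can cite (or refute under `Negative/`) the exact test
statement by name.  Contains ONLY the `@[conjecture] def … : Prop` (an OPEN statement in our theories — human rule 2026-08-15:
tagged `@[conjecture]`, an obligation node provable / refutable BY NAME, never a Literature fact; decidable PER INSTANCE, unknown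
class-wide) — the registered v16 stub text VERBATIM — and an `Iff.rfl` readback lemma.  ROUTE-INDEPENDENT (no `Theses` import);
no instance, no notation, no theorem content, no `sorry`.

WHAT THE CONSTANT SAYS (K1″).  On bucket B (`E′` multiplicative and très ramifié at `3`, `ρ̄₃` onto, conductor `N′`; `K` imaginary
quadratic Heegner for `N′` with odd `d_K`) and at ANY degree-one prime `𝔭 ∋ 3` of `K`, for every anticyclotomic `ℤ₃`-extension `κ`:
for SOME modular parametrisation datum `Dt` of `E′` at level `N′`, orientation `β` (`4N′ ∣ β² − d_K`), embedding `jbar : K̄ → ℂ`,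
layer `k` and transversal `R ⊆ Gal(K̄/K_k)` of `Gal(K̄/K[3^{k+1}])`, the norm point `∑_{r ∈ R} r • x ∈ E′(K_k)` of the PRINCIPAL
Heegner point `x` of conductor `3^{k+1}` (`complexPoint x = y(3^{k+1})`, the good CM point `(𝒪_{3^{k+1}} → 𝒪_{3^k})` of `X₀(N′)`)
is LOCALLY `3`-INDIVISIBLE at `𝔭`: it is not `3 • P` for any `P ∈ E′(K̄)` fixed by `Γ_{K_k} ∩ D_𝔭`.  Instrument-decidable per
`(E′, K, 𝔭, k)` (cert-utdbuckets); at split multiplicative `3` the witness layer must be `k ≥ 1` (exceptional zero), at non-split `3`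
`k = 0` is admissible.  Declaring the constant proves nothing: crux 24737 stays OPEN and BSD is proved for no curve by this file.

References: [Castella2024] §2.2, Thm. 2.1 (the points `y_{p^m}` at `p ∥ N`; exceptional zero); [BertoliniDarmon1996] §2.5;
[GrossLMS1991] §3 (Heegner points of conductor `c` on `X₀(N)`).
-/

noncomputable section

open scoped Classical NumberField

set_option linter.dupNamespace false -- `…BirchSwinnertonDyer.BirchSwinnertonDyer…` is the cell's nested layout (D-0017)
set_option autoImplicit false

namespace Summit.BirchSwinnertonDyer.BirchSwinnertonDyer.Theorems.UniversalToricDescentPrincipalHeegnerIndivisibleDefs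

open NumberField IsDedekindDomain Field WeierstrassCurve Finset
open Literature.NumberTheory.EllipticCurves Literature.NumberTheory.EllipticCurves.ZpExtension
open Literature.NumberTheory.EllipticCurves.GreenbergSelmer
open Literature.NumberTheory.EllipticCurves.ModularForms (ModularParametrizationData heegnerPointComplexOfConductor)

/-- **`PrincipalHeegnerIndivisibleMultAtThree`** (K1″ of line `beta-road` on crux 24737 — the registered stub
`stub_principalHeegnerIndivisibleMult` of skeleton v16, sha16 `a84e0bb203085cb5`, VERBATIM as a named `Prop`).  For every bucket-B
twin `W′/ℚ` (multiplicative at `3` with `3 ∤ v₃(Δ′)`, `ρ̄₃` onto, conductor `N′`), every imaginary quadratic `K` Heegner for `N′` with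
odd discriminant, every anticyclotomic `ℤ₃`-extension `κ` and every degree-one prime `𝔭 ∋ 3` of `K`: there are `jbar`, `Dt`, `β`
(`4N′ ∣ β² − d_K`), `k`, a point `x ∈ E′(K̄)` with `complexPoint W′ jbar x = heegnerPointComplexOfConductor Dt d_K β 3^{k+1}` and a
transversal `R ⊆ Γ_{K_k}` of `Gal(K̄/K[3^{k+1}])` such that `3 • P ≠ ∑_{r ∈ R} r • x` for every `P` fixed by `Γ_{K_k} ⊓ D_𝔭`.
RESEARCH (decidable per instance, unknown class-wide); a definition only, nothing is proved by it.
[cite: Castella2024, §2.2 and Thm. 2.1 (shape of the points y_{p^m} at p ∥ N; nothing asserted)] [cite: BertoliniDarmon1996, §2.5 (shape; nothing asserted)] [cite: GrossLMS1991, §3 (Heegner points of conductor c; shape)] -/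
@[conjecture]
def PrincipalHeegnerIndivisibleMultAtThree : Prop :=
    ∀ (W' : WeierstrassCurve ℚ) [W'.IsElliptic] [W'.IsGloballyMinimal] (N' : ℕ) [NeZero N']
      (K : Type) [Field K] [NumberField K],
      Rank1Residual.Mult W' 3 → ¬ 3 ∣ padicValInt 3 W'.minimalDiscriminantInt →
      W'.HasSurjectiveModNGaloisRep 3 → W'.conductorNorm ℤ = N' → IsImaginaryQuadratic K →
      SatisfiesHeegnerHypothesis N' K → Odd (NumberField.discr K) →
      ∀ (κ : ZpExtension K 3), κ.IsAnticyclotomic →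
      ∀ (𝔭 : HeightOneSpectrum (𝓞 K)), ((3 : ℕ) : 𝓞 K) ∈ 𝔭.asIdeal →
        𝔭.asIdeal.ramificationIdx (𝓞 ℚ) = 1 → 𝔭.asIdeal.inertiaDeg (𝓞 ℚ) = 1 →
      ∃ (jbar : AlgebraicClosure K →+* ℂ) (Dt : ModularParametrizationData W' N') (β : ℤ)
        (_ : (4 * N' : ℤ) ∣ β ^ 2 - NumberField.discr K) (k : ℕ)
        (x : geomPoints (W'.baseChange K)) (R : Finset (absoluteGaloisGroup K)),
        complexPoint W' jbar x = heegnerPointComplexOfConductor Dt (NumberField.discr K) β (3 ^ (k + 1)) ∧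
        (↑R ⊆ (κ.layerSubgroup k : Set (absoluteGaloisGroup K))) ∧
        (∀ τ ∈ κ.layerSubgroup k, ∃! r, r ∈ R ∧ r⁻¹ * τ ∈ ringClassSubgroup K (3 ^ (k + 1)) jbar) ∧
        ∀ (P : geomPoints (W'.baseChange K)), (∀ σ ∈ κ.layerSubgroup k ⊓ decomp 𝔭, σ • P = P) →
          (3 : ℤ) • P ≠ ∑ r ∈ R, r • x

/-- **Readback** (`Iff.rfl`): `PrincipalHeegnerIndivisibleMultAtThree` unfolds to the registered `stub_principalHeegnerIndivisibleMult`
text of skeleton v16 (sha16 `a84e0bb203085cb5`) literally. [cite: Castella2024, §2.2 (shape; nothing asserted)] -/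
theorem principalHeegnerIndivisibleMultAtThree_iff :
    PrincipalHeegnerIndivisibleMultAtThree ↔
    ∀ (W' : WeierstrassCurve ℚ) [W'.IsElliptic] [W'.IsGloballyMinimal] (N' : ℕ) [NeZero N']
      (K : Type) [Field K] [NumberField K],
      Rank1Residual.Mult W' 3 → ¬ 3 ∣ padicValInt 3 W'.minimalDiscriminantInt →
      W'.HasSurjectiveModNGaloisRep 3 → W'.conductorNorm ℤ = N' → IsImaginaryQuadratic K →
      SatisfiesHeegnerHypothesis N' K → Odd (NumberField.discr K) →
      ∀ (κ : ZpExtension K 3), κ.IsAnticyclotomic →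
      ∀ (𝔭 : HeightOneSpectrum (𝓞 K)), ((3 : ℕ) : 𝓞 K) ∈ 𝔭.asIdeal →
        𝔭.asIdeal.ramificationIdx (𝓞 ℚ) = 1 → 𝔭.asIdeal.inertiaDeg (𝓞 ℚ) = 1 →
      ∃ (jbar : AlgebraicClosure K →+* ℂ) (Dt : ModularParametrizationData W' N') (β : ℤ)
        (_ : (4 * N' : ℤ) ∣ β ^ 2 - NumberField.discr K) (k : ℕ)
        (x : geomPoints (W'.baseChange K)) (R : Finset (absoluteGaloisGroup K)),
        complexPoint W' jbar x = heegnerPointComplexOfConductor Dt (NumberField.discr K) β (3 ^ (k + 1)) ∧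
        (↑R ⊆ (κ.layerSubgroup k : Set (absoluteGaloisGroup K))) ∧
        (∀ τ ∈ κ.layerSubgroup k, ∃! r, r ∈ R ∧ r⁻¹ * τ ∈ ringClassSubgroup K (3 ^ (k + 1)) jbar) ∧
        ∀ (P : geomPoints (W'.baseChange K)), (∀ σ ∈ κ.layerSubgroup k ⊓ decomp 𝔭, σ • P = P) →
          (3 : ℤ) • P ≠ ∑ r ∈ R, r • x :=
  Iff.rfl

end Summit.BirchSwinnertonDyer.BirchSwinnertonDyer.Theorems.UniversalToricDescentPrincipalHeegnerIndivisibleDefs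

end
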